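import Mathlib
import Literature.NumberTheory.Transcendental.AssociatorsRegularisation
import HarnessLib

/-!
# Iterated integrals and transport series along an interval (Chen's calculus, coefficientwise)

First proofs file towards `drinfeldAssociator_pentagon` (`DrinfeldAssociator.lean`,
[Drinfeld1991, (2.13)]): the one-dimensional analysis on which both halves of Drinfeld's argument
rest — the identification of `Φ_KZ` with the regularised transport of
`G'(u) = (A/u + B/(u-1)) G(u)` from `0` to `1` [Furusho2003, Def. 3.1.1, Prop. 3.2.3] and the
holonomy of the KZ connection around the pentagon cell of `M_{0,5}(ℝ)` [Drinfeld1991, §2].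
Everything is done COEFFICIENTWISE: a connection form `Σ_c τ_c ⊗ f_c(t) dt` with letters `c : α`
is recorded by its real densities `f : α → ℝ → ℝ`, and its transport ("path-ordered
exponential") is the FREE non-commutative series `transportSeries f a b : NCSeries α ℝ` whose
coefficient at the word `w = c₁ ⋯ c_n` is the iterated integral
`iterInt f w a b = ∫_{a < t_n < ⋯ < t_1 < b} f_{c₁}(t₁) ⋯ f_{c_n}(t_n) dt`
(leftmost letter = outermost integration, as in [Furusho2003, §3.2]); algebras such as the
truncated Drinfeld–Kohno algebras only enter later through `NCSeries.evalTrunc`.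

## Contents (everything here is proved; no named fact is introduced)

* `NCSeries.letterSeries g = Σ_c g(c) c` and its convolution identities; sums over the
  deconcatenations of `u c` (`NCSeries.sum_splits_append_singleton`).
* `iterInt f w a b` (nested interval integrals, densities continuous on an open interval `s ∋ a, b`):
  continuity and the FTC in the upper limit (`hasDerivAt_iterInt_cons`), **Chen's identity**
  `I_w(a,c) = Σ_{w = uv} I_u(b,c) I_v(a,b)` (`iterInt_chen`, `transportSeries_chen`:
  `T̂(a,c) = T̂(b,c) T̂(a,b)`), the reversal `T̂(b,a) T̂(a,b) = 1`, **Ree's shuffle relation**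
  `I_u I_v = Σ_{w ∈ u ш v} I_w` (`iterInt_mul_eq_sum_shuffleWord`), i.e. the transport series is
  group-like (`isGroupLike_transportSeries`, in the sense of `NCSeries.IsGroupLike`).
* The derivative in the LOWER limit, `∂_a T̂(a,b) = -T̂(a,b) ω(a)`
  (`hasDerivAt_transportSeries_left`, from `T̂(b,a) T̂(a,b) = 1` by induction on the length), whence
  the right recursion `I_{uc}(a,b) = ∫_a^b I_u(t,b) f_c(t) dt` (`iterInt_append_singleton`).
* Bounds: the crude product bound `|I_w(a,b)| ≤ Π_i ‖f_{w_i}‖_{L¹[a,b]}` (`abs_iterInt_le_prod`),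
  positivity/monotonicity for nonnegative densities, and the two refined bounds near a logarithmic
  endpoint (`abs_iterInt_le_of_last_bdd`: `O(x^q)` on `[a,x]` near `0` for words ending with a
  bounded letter; `abs_iterInt_le_of_head_bdd`: `O((1-x)^q)` on `[x,b]` near `1` for words starting
  with one) that drive the regularisation `ε → 0`.
* Reparametrisation invariance under `C¹` changes of variable (`iterInt_comp`).

## References

* K.-T. Chen, *Iterated path integrals*, Bull. AMS 83 (1977), 831–879 (§1–2: iterated integrals,
  the product formula, the shuffle relation). Standard material: tagged `[folklore]`.
* H. Furusho, Publ. RIMS 39 (2003), §3.1–3.2 (arXiv:math/0011261, pp. 9–10): conventions for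
  `Φ_KZ` and iterated integrals. [Furusho2003]
* V. G. Drinfel'd, Leningrad Math. J. 2 (1991), 829–860, §2. [Drinfeld1991]
-/

noncomputable section

open MeasureTheory intervalIntegral Set Filter
open scoped BigOperators Topology

namespace Literature.NumberTheory.Transcendental

universe u

variable {α : Type u}


namespace NCSeries
variable {R : Type*} [CommRing R]

/-- The **letter series** `Σ_c g(c) · c` (supported on words of length one). [folklore] -/
def letterSeries (g : α → R) : NCSeries α R := fun w =>
  match w with
  | [c] => g c
  | _ => 0

/-- `ω(∅) = 0`. [folklore] -/
@[simp] theorem letterSeries_nil (g : α → R) : letterSeries g ([] : List α) = 0 := rfl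
/-- `ω(c) = g(c)`. [folklore] -/
@[simp] theorem letterSeries_singleton (g : α → R) (c : α) : letterSeries g [c] = g c := rfl
/-- `ω` vanishes on words of length `≥ 2`. [folklore] -/
theorem letterSeries_cons_cons (g : α → R) (c d : α) (w : List α) :
    letterSeries g (c :: d :: w) = 0 := rfl

/-- `ω` is supported on words of length one. [folklore] -/
theorem letterSeries_eq_zero_of_length_ne_one (g : α → R) {w : List α} (hw : w.length ≠ 1) :
    letterSeries g w = 0 := by
  match w, hw with
  | [], _ => rfl
  | [c], h => exact absurd rfl h
  | c :: d :: w, _ => rfl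

/-- `(ω * S)(c w) = g(c) S(w)`. [folklore] -/
theorem letterSeries_mul_apply_cons (g : α → R) (S : NCSeries α R) (c : α) (w : List α) :
    (letterSeries g * S) (c :: w) = g c * S w := by
  rw [mul_apply, sum_splits_cons, letterSeries_nil, zero_mul, zero_add]
  cases w with
  | nil => simp [splits]
  | cons d w =>
    rw [sum_splits_cons, Finset.sum_eq_zero]
    · simp
    · intro p _
      simp [letterSeries_cons_cons]

/-- `(ω * S)(∅) = 0`. [folklore] -/
@[simp] theorem letterSeries_mul_apply_nil (g : α → R) (S : NCSeries α R) :
    (letterSeries g * S) [] = 0 := by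
  simp [mul_apply, splits]

/-- Sum over the deconcatenations of `u ++ [c]`. [folklore] -/
theorem sum_splits_append_singleton {M : Type*} [AddCommMonoid M] (u : List α) (c : α)
    (G : List α × List α → M) :
    ∑ p ∈ splits (u ++ [c]), G p = (∑ p ∈ splits u, G (p.1, p.2 ++ [c])) + G (u ++ [c], []) := by
  rw [sum_splits_eq_sum_range, sum_splits_eq_sum_range, List.length_append, List.length_singleton,
    Finset.sum_range_succ]
  congr 1
  · refine Finset.sum_congr rfl fun k hk => ?_
    rw [Finset.mem_range] at hk
    rw [List.take_append_of_le_length (by omega), List.drop_append_of_le_length (by omega)]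
  · rw [List.take_of_length_le (by simp), List.drop_eq_nil_of_le (by simp)]

/-- `(S * ω)(u c) = S(u) g(c)`. [folklore] -/
theorem mul_letterSeries_apply_append_singleton (g : α → R) (S : NCSeries α R) (u : List α)
    (c : α) : (S * letterSeries g) (u ++ [c]) = S u * g c := by
  rw [mul_apply, sum_splits_append_singleton, letterSeries_nil, mul_zero, add_zero]
  induction u using List.reverseRecOn with
  | nil => simp [splits]
  | append_singleton u d _ =>
    rw [sum_splits_append_singleton, Finset.sum_eq_zero, zero_add]
    · simp
    · intro p _
      simp only [List.append_assoc, List.singleton_append]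
      rw [letterSeries_eq_zero_of_length_ne_one, mul_zero]
      simp

/-- `(S * ω)(∅) = 0`. [folklore] -/
@[simp] theorem mul_letterSeries_apply_nil (g : α → R) (S : NCSeries α R) :
    (S * letterSeries g) [] = 0 := by
  simp [mul_apply, splits]

/-- The convolution split off at the empty prefix. [folklore] -/
theorem mul_apply_eq_add_sum_erase [DecidableEq α] (P Q : NCSeries α R) (w : List α) :
    (P * Q) w = P [] * Q w + ∑ p ∈ (splits w).erase ([], w), P p.1 * Q p.2 := by
  rw [mul_apply, ← Finset.add_sum_erase _ _ (nil_self_mem_splits w)]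

/-- The convolution split off at the empty suffix. [folklore] -/
theorem mul_apply_eq_add_sum_erase' [DecidableEq α] (P Q : NCSeries α R) (w : List α) :
    (P * Q) w = P w * Q [] + ∑ p ∈ (splits w).erase (w, []), P p.1 * Q p.2 := by
  rw [mul_apply, ← Finset.add_sum_erase _ _ (self_nil_mem_splits w)]

end NCSeries

/-- The **iterated integral** of the word `w = c₁ ⋯ c_n` for the letter densities `f : α → ℝ → ℝ`
from `a` to `b`: `I_∅ = 1`, `I_{cw}(a,b) = ∫_a^b f_c(t) I_w(a,t) dt`, i.e. `∫_{a<t_n<⋯<t_1<b}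
f_{c₁}(t₁)⋯f_{c_n}(t_n)` — the leftmost letter is the OUTERMOST integration [Furusho2003, §3.2; Chen
1977, §1]. [folklore] -/
def iterInt (f : α → ℝ → ℝ) : List α → ℝ → ℝ → ℝ
  | [], _, _ => 1
  | c :: w, a, b => ∫ t in a..b, f c t * iterInt f w a t

/-- `I_∅(a,b) = 1`. [folklore] -/
@[simp] theorem iterInt_nil (f : α → ℝ → ℝ) (a b : ℝ) : iterInt f [] a b = 1 := rfl

/-- The defining recursion `I_{cw}(a,b) = ∫_a^b f_c(t) I_w(a,t) dt` (first letter outermost).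
[folklore] -/
theorem iterInt_cons (f : α → ℝ → ℝ) (c : α) (w : List α) (a b : ℝ) :
    iterInt f (c :: w) a b = ∫ t in a..b, f c t * iterInt f w a t := rfl

/-- `I_w(a,a) = 0` for a nonempty word. [folklore] -/
theorem iterInt_self_of_ne_nil (f : α → ℝ → ℝ) {w : List α} (hw : w ≠ []) (a : ℝ) :
    iterInt f w a a = 0 := by
  cases w with
  | nil => exact absurd rfl hw
  | cons c w => simp [iterInt_cons]

/-- FTC for the primitive `u ↦ ∫_a^u g` of a function continuous on an open interval. [folklore] -/
theorem hasDerivAt_integral_of_continuousOn' {g : ℝ → ℝ} {s : Set ℝ} (hs : IsOpen s)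
    (hso : s.OrdConnected) (hg : ContinuousOn g s) {a b : ℝ} (ha : a ∈ s) (hb : b ∈ s) :
    HasDerivAt (fun u => ∫ t in a..u, g t) (g b) b :=
  intervalIntegral.integral_hasDerivAt_right
    ((hg.mono (hso.uIcc_subset ha hb)).intervalIntegrable)
    (hg.stronglyMeasurableAtFilter hs _ hb) (hg.continuousAt (hs.mem_nhds hb))


/-- Continuity of a list sum of functions. [folklore] -/
theorem continuousOn_list_sum_map {ι : Type*} {s : Set ℝ} (L : List ι) {g : ι → ℝ → ℝ}
    (hg : ∀ i ∈ L, ContinuousOn (g i) s) : ContinuousOn (fun t => (L.map fun i => g i t).sum) s := by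
  induction L with
  | nil => simpa using continuousOn_const
  | cons i L ih =>
    simp only [List.map_cons, List.sum_cons]
    exact (hg i (by simp)).add (ih fun j hj => hg j (by simp [hj]))

/-- Interval integrability of a list sum of functions. [folklore] -/
theorem intervalIntegrable_list_sum_map {ι : Type*} (L : List ι) {g : ι → ℝ → ℝ} {b b' : ℝ}
    (hg : ∀ i ∈ L, IntervalIntegrable (g i) volume b b') :
    IntervalIntegrable (fun t => (L.map fun i => g i t).sum) volume b b' := by
  induction L with
  | nil => simp
  | cons i L ih =>
    simp only [List.map_cons, List.sum_cons]
    exact (hg i (by simp)).add (ih fun j hj => hg j (by simp [hj]))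

/-- The interval integral of a list sum is the list sum of the integrals. [folklore] -/
theorem integral_list_sum_map {ι : Type*} (L : List ι) (g : ι → ℝ → ℝ) {b b' : ℝ}
    (hg : ∀ i ∈ L, IntervalIntegrable (g i) volume b b') :
    ∫ t in b..b', (L.map fun i => g i t).sum = (L.map fun i => ∫ t in b..b', g i t).sum := by
  induction L with
  | nil => simp
  | cons i L ih =>
    have hL : ∀ j ∈ L, IntervalIntegrable (g j) volume b b' := fun j hj => hg j (by simp [hj])
    simp only [List.map_cons, List.sum_cons]
    rw [intervalIntegral.integral_add (hg i (by simp)) (intervalIntegrable_list_sum_map L hL), ih hL]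

section Regularity

variable {f : α → ℝ → ℝ} {s : Set ℝ} (hs : IsOpen s) (hso : s.OrdConnected)
  (hf : ∀ c, ContinuousOn (f c) s) {a : ℝ} (ha : a ∈ s)
include hs hso hf ha

/-- Continuity of `b ↦ I_w(a,b)` on the interval of continuity of the densities. [folklore] -/
theorem continuousOn_iterInt : ∀ w : List α, ContinuousOn (fun b => iterInt f w a b) s
  | [] => by simpa using continuousOn_const
  | c :: w => by
    have hg : ContinuousOn (fun t => f c t * iterInt f w a t) s := (hf c).mul (continuousOn_iterInt w)
    refine continuousOn_of_forall_continuousAt fun b hb => ?_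
    simpa [iterInt_cons] using
      (hasDerivAt_integral_of_continuousOn' hs hso hg ha hb).continuousAt

/-- Continuity of the integrand `f_c(t) I_w(a,t)`. [folklore] -/
theorem continuousOn_mul_iterInt (c : α) (w : List α) :
    ContinuousOn (fun t => f c t * iterInt f w a t) s :=
  (hf c).mul (continuousOn_iterInt hs hso hf ha w)

/-- **FTC in the upper limit**: `∂_b I_{cw}(a,b) = f_c(b) I_w(a,b)`. [folklore] -/
theorem hasDerivAt_iterInt_cons (c : α) (w : List α) {b : ℝ} (hb : b ∈ s) :
    HasDerivAt (fun u => iterInt f (c :: w) a u) (f c b * iterInt f w a b) b := by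
  simpa [iterInt_cons] using
    hasDerivAt_integral_of_continuousOn' hs hso (continuousOn_mul_iterInt hs hso hf ha c w) ha hb

/-- Interval integrability of the integrand `f_c(t) I_w(a,t)`. [folklore] -/
theorem intervalIntegrable_mul_iterInt (c : α) (w : List α) {b b' : ℝ} (hb : b ∈ s) (hb' : b' ∈ s) :
    IntervalIntegrable (fun t => f c t * iterInt f w a t) volume b b' :=
  ((continuousOn_mul_iterInt hs hso hf ha c w).mono (hso.uIcc_subset hb hb')).intervalIntegrable

/-- **Chen's identity** (coefficientwise): `I_w(a,c) = Σ_{w = uv} I_u(b,c) I_v(a,b)` for any three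
points of the interval (Chen 1977, §1). [folklore] -/
theorem iterInt_chen {b : ℝ} (hb : b ∈ s) :
    ∀ (w : List α) {c : ℝ}, c ∈ s →
      iterInt f w a c = ∑ p ∈ NCSeries.splits w, iterInt f p.1 b c * iterInt f p.2 a b
  | [], c, hc => by simp [NCSeries.splits]
  | d :: w, c, hc => by
    rw [NCSeries.sum_splits_cons, iterInt_nil, one_mul, iterInt_cons, iterInt_cons,
      ← integral_add_adjacent_intervals (intervalIntegrable_mul_iterInt hs hso hf ha d w ha hb)
        (intervalIntegrable_mul_iterInt hs hso hf ha d w hb hc)]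
    congr 1
    have hcongr : ∀ t ∈ uIcc b c, f d t * iterInt f w a t =
        ∑ p ∈ NCSeries.splits w, f d t * iterInt f p.1 b t * iterInt f p.2 a b := by
      intro t ht
      rw [iterInt_chen hb w (hso.uIcc_subset hb hc ht), Finset.mul_sum]
      simp_rw [mul_assoc]
    rw [integral_congr hcongr, intervalIntegral.integral_finsetSum]
    · refine Finset.sum_congr rfl fun p _ => ?_
      rw [iterInt_cons, ← intervalIntegral.integral_mul_const]
    · intro p _
      exact ((intervalIntegrable_mul_iterInt hs hso hf hb d p.1 hb hc).mul_const _)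


/-- **Ree's shuffle relation** for iterated integrals over a common interval: `I_u(a,b) I_v(a,b) =
Σ_{w ∈ u ш v} I_w(a,b)`, shuffles listed with multiplicity by `MZV.shuffleWord` (Chen 1977, (1.5.1);
Ree 1958). [folklore] -/
theorem iterInt_mul_eq_sum_shuffleWord :
    ∀ (u v : List α) {b : ℝ}, b ∈ s →
      iterInt f u a b * iterInt f v a b = ((MZV.shuffleWord u v).map fun w => iterInt f w a b).sum
  | [], v, b, _ => by simp
  | c :: u, [], b, _ => by simp
  | c :: u, d :: v, b, hb => by
    -- derivative of the product
    have hderiv : ∀ t ∈ uIcc a b, HasDerivAt (fun x => iterInt f (c :: u) a x * iterInt f (d :: v) a x)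
        (f c t * iterInt f u a t * iterInt f (d :: v) a t +
          iterInt f (c :: u) a t * (f d t * iterInt f v a t)) t := fun t ht =>
      (hasDerivAt_iterInt_cons hs hso hf ha c u (hso.uIcc_subset ha hb ht)).mul
        (hasDerivAt_iterInt_cons hs hso hf ha d v (hso.uIcc_subset ha hb ht))
    have hcont : ContinuousOn (fun t => f c t * iterInt f u a t * iterInt f (d :: v) a t +
          iterInt f (c :: u) a t * (f d t * iterInt f v a t)) s :=
      ((continuousOn_mul_iterInt hs hso hf ha c u).mul (continuousOn_iterInt hs hso hf ha _)).add
        ((continuousOn_iterInt hs hso hf ha _).mul (continuousOn_mul_iterInt hs hso hf ha d v))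
    have hint : IntervalIntegrable (fun t => f c t * iterInt f u a t * iterInt f (d :: v) a t +
          iterInt f (c :: u) a t * (f d t * iterInt f v a t)) volume a b :=
      (hcont.mono (hso.uIcc_subset ha hb)).intervalIntegrable
    have hFTC := integral_eq_sub_of_hasDerivAt hderiv hint
    rw [iterInt_self_of_ne_nil f (List.cons_ne_nil c u), zero_mul, sub_zero] at hFTC
    rw [← hFTC]
    -- rewrite the integrand by induction hypotheses
    have hcongr : ∀ t ∈ uIcc a b,
        f c t * iterInt f u a t * iterInt f (d :: v) a t + iterInt f (c :: u) a t * (f d t * iterInt f v a t) =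
        ((MZV.shuffleWord u (d :: v)).map fun w => f c t * iterInt f w a t).sum +
          ((MZV.shuffleWord (c :: u) v).map fun w => f d t * iterInt f w a t).sum := by
      intro t ht
      have ht' : t ∈ s := hso.uIcc_subset ha hb ht
      rw [mul_assoc, iterInt_mul_eq_sum_shuffleWord u (d :: v) ht', mul_left_comm,
        iterInt_mul_eq_sum_shuffleWord (c :: u) v ht', ← List.sum_map_mul_left, ← List.sum_map_mul_left]
    rw [integral_congr hcongr, intervalIntegral.integral_add, integral_list_sum_map, integral_list_sum_map,
      MZV.shuffleWord_cons_cons, List.map_append, List.sum_append, List.map_map, List.map_map]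
    · simp only [Function.comp_def, iterInt_cons]
    · intro w _; exact intervalIntegrable_mul_iterInt hs hso hf ha d w ha hb
    · intro w _; exact intervalIntegrable_mul_iterInt hs hso hf ha c w ha hb
    · exact ((continuousOn_list_sum_map _ fun w _ => continuousOn_mul_iterInt hs hso hf ha c w).mono
        (hso.uIcc_subset ha hb)).intervalIntegrable
    · exact ((continuousOn_list_sum_map _ fun w _ => continuousOn_mul_iterInt hs hso hf ha d w).mono
        (hso.uIcc_subset ha hb)).intervalIntegrable

end Regularity

section Series

variable {f : α → ℝ → ℝ} {s : Set ℝ} (hs : IsOpen s) (hso : s.OrdConnected)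
  (hf : ∀ c, ContinuousOn (f c) s)
include hs hso hf

/-- Reversal identity: `Σ_{w = u v} I_u(b,a) I_v(a,b) = δ_{w,∅}`. [folklore] -/
theorem sum_splits_iterInt_reverse {a b : ℝ} (ha : a ∈ s) (hb : b ∈ s) (w : List α) :
    ∑ p ∈ NCSeries.splits w, iterInt f p.1 b a * iterInt f p.2 a b = if w = [] then 1 else 0 := by
  rw [← iterInt_chen hs hso hf ha hb w ha]
  split_ifs with hw
  · subst hw; rfl
  · exact iterInt_self_of_ne_nil f hw a

/-- The **transport series** of the letter densities `f` from `a` to `b`. [folklore] -/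
def transportSeries (f : α → ℝ → ℝ) (a b : ℝ) : NCSeries α ℝ := fun w => iterInt f w a b

omit hs hso hf in
/-- Coefficients of the transport series are the iterated integrals. [folklore] -/
@[simp] theorem transportSeries_apply (f : α → ℝ → ℝ) (a b : ℝ) (w : List α) :
    transportSeries f a b w = iterInt f w a b := rfl

omit hs hso hf in
/-- The transport series has constant term `1`. [folklore] -/
@[simp] theorem transportSeries_apply_nil (f : α → ℝ → ℝ) (a b : ℝ) :
    transportSeries f a b [] = 1 := rfl

omit hs hso hf in
/-- `T̂(a,a) = 1`. [folklore] -/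
theorem transportSeries_self (f : α → ℝ → ℝ) (a : ℝ) : transportSeries f a a = 1 := by
  ext w
  cases w with
  | nil => rfl
  | cons c w => simp [iterInt_cons]

/-- **Chen's identity** `T̂(a,c) = T̂(b,c) * T̂(a,b)`. [folklore] -/
theorem transportSeries_chen {a b c : ℝ} (ha : a ∈ s) (hb : b ∈ s) (hc : c ∈ s) :
    transportSeries f a c = transportSeries f b c * transportSeries f a b := by
  ext w
  rw [NCSeries.mul_apply]
  exact iterInt_chen hs hso hf ha hb w hc

/-- `T̂(b,a) * T̂(a,b) = 1`. [folklore] -/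
theorem transportSeries_reverse_mul {a b : ℝ} (ha : a ∈ s) (hb : b ∈ s) :
    transportSeries f b a * transportSeries f a b = 1 := by
  rw [← transportSeries_chen hs hso hf ha hb ha, transportSeries_self]

/-- `T̂(a,b) * T̂(b,a) = 1`. [folklore] -/
theorem transportSeries_mul_reverse {a b : ℝ} (ha : a ∈ s) (hb : b ∈ s) :
    transportSeries f a b * transportSeries f b a = 1 :=
  transportSeries_reverse_mul hs hso hf hb ha

/-- The transport series is **group-like**. [folklore] -/
theorem isGroupLike_transportSeries {a b : ℝ} (ha : a ∈ s) (hb : b ∈ s) :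
    NCSeries.IsGroupLike (transportSeries f a b) :=
  ⟨rfl, fun u v => iterInt_mul_eq_sum_shuffleWord hs hso hf ha u v hb⟩

end Series

section Bounds


/-- Monotonicity of a product of nonnegative reals along a list. [folklore] -/
theorem list_prod_map_le_prod_map {ι : Type*} (L : List ι) {F G : ι → ℝ}
    (h0 : ∀ i ∈ L, 0 ≤ F i) (h1 : ∀ i ∈ L, F i ≤ G i) : (L.map F).prod ≤ (L.map G).prod := by
  induction L with
  | nil => simp
  | cons i L ih =>
    simp only [List.map_cons, List.prod_cons]
    have hF : 0 ≤ (L.map F).prod := List.prod_nonneg (by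
      intro x hx; obtain ⟨j, hj, rfl⟩ := List.mem_map.mp hx; exact h0 j (by simp [hj]))
    exact mul_le_mul (h1 i (by simp)) (ih (fun j hj => h0 j (by simp [hj])) fun j hj => h1 j (by simp [hj]))
      hF ((h0 i (by simp)).trans (h1 i (by simp)))

variable {f : α → ℝ → ℝ} {s : Set ℝ} (hs : IsOpen s) (hso : s.OrdConnected)
  (hf : ∀ c, ContinuousOn (f c) s)
include hs hso hf

omit hs in
/-- Monotonicity of `∫_a^t |f c|` in `t`. [folklore] -/
theorem integral_abs_mono_right {a t b : ℝ} (ha : a ∈ s) (hb : b ∈ s) (hat : a ≤ t) (htb : t ≤ b)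
    (c : α) : ∫ x in a..t, |f c x| ≤ ∫ x in a..b, |f c x| :=
  intervalIntegral.integral_mono_interval le_rfl hat htb
    (Eventually.of_forall fun _ => abs_nonneg _)
    (((hf c).mono (hso.uIcc_subset ha hb)).abs.intervalIntegrable)

/-- Crude bound `|I_w(a,b)| ≤ Π_i ∫_a^b |f_{w_i}|` for `a ≤ b`. [folklore] -/
theorem abs_iterInt_le_prod {a : ℝ} (ha : a ∈ s) :
    ∀ (w : List α) {b : ℝ}, b ∈ s → a ≤ b →
      |iterInt f w a b| ≤ (w.map fun c => ∫ t in a..b, |f c t|).prod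
  | [], b, _, _ => by simp
  | c :: w, b, hb, hab => by
    rw [iterInt_cons, List.map_cons, List.prod_cons]
    have hsub : uIcc a b ⊆ s := hso.uIcc_subset ha hb
    have hcont : ContinuousOn (fun t => f c t * iterInt f w a t) (uIcc a b) :=
      (continuousOn_mul_iterInt hs hso hf ha c w).mono hsub
    calc |∫ t in a..b, f c t * iterInt f w a t|
        ≤ ∫ t in a..b, |f c t * iterInt f w a t| :=
          abs_integral_le_integral_abs hab
      _ ≤ ∫ t in a..b, |f c t| * (w.map fun c => ∫ t in a..b, |f c t|).prod := by
          refine integral_mono_on hab hcont.abs.intervalIntegrable ?_ fun t ht => ?_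
          · exact (((hf c).mono hsub).abs.intervalIntegrable).mul_const _
          · rw [abs_mul]
            have hts : t ∈ s := hsub (by rw [uIcc_of_le hab]; exact ht)
            refine mul_le_mul_of_nonneg_left ((abs_iterInt_le_prod ha w hts ht.1).trans ?_)
              (abs_nonneg _)
            refine list_prod_map_le_prod_map w (fun c' _ => ?_) fun c' _ => ?_
            · exact intervalIntegral.integral_nonneg ht.1 fun x _ => abs_nonneg _
            · exact integral_abs_mono_right hso hf ha hb ht.1 ht.2 c'
      _ = (∫ t in a..b, |f c t|) * (w.map fun c => ∫ t in a..b, |f c t|).prod :=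
          intervalIntegral.integral_mul_const _ _

end Bounds

section LowerLimit

variable {f : α → ℝ → ℝ} {s : Set ℝ} (hs : IsOpen s) (hso : s.OrdConnected)
  (hf : ∀ c, ContinuousOn (f c) s)
include hs hso hf

/-- Upper-limit derivative at the series level: `∂_b T̂(a,b) = ω(b) * T̂(a,b)` coefficientwise.
[folklore] -/
theorem hasDerivAt_transportSeries_right {a b : ℝ} (ha : a ∈ s) (hb : b ∈ s) (w : List α) :
    HasDerivAt (fun x => transportSeries f a x w)
      ((NCSeries.letterSeries (fun c => f c b) * transportSeries f a b) w) b := by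
  cases w with
  | nil => simpa using hasDerivAt_const b (1 : ℝ)
  | cons c w =>
    rw [NCSeries.letterSeries_mul_apply_cons]
    exact hasDerivAt_iterInt_cons hs hso hf ha c w hb

/-- **Lower-limit derivative**: `∂_a T̂(a,b) = -T̂(a,b) * ω(a)` coefficientwise. [folklore] -/
theorem hasDerivAt_transportSeries_left [DecidableEq α] {b : ℝ} (hb : b ∈ s) :
    ∀ (n : ℕ) (w : List α), w.length ≤ n → ∀ {a : ℝ}, a ∈ s →
      HasDerivAt (fun x => transportSeries f x b w)
        (-(transportSeries f a b * NCSeries.letterSeries (fun c => f c a)) w) a := by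
  intro n
  induction n with
  | zero =>
    intro w hw a ha
    rw [List.length_eq_zero_iff.mp (Nat.le_zero.mp hw)]
    simpa using hasDerivAt_const a (1 : ℝ)
  | succ n ih =>
    intro w hw a ha
    by_cases hne : w = []
    · subst hne; simpa using hasDerivAt_const a (1 : ℝ)
    obtain ⟨u, c, rfl⟩ : ∃ u c, w = u ++ [c] :=
      ⟨w.dropLast, w.getLast hne, (List.dropLast_append_getLast hne).symm⟩
    -- notation: S x = T̂(b,x), U x = T̂(x,b), ω x = letter series at x
    have hSU : ∀ x ∈ s, transportSeries f b x * transportSeries f x b = 1 := fun x hx =>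
      transportSeries_reverse_mul hs hso hf hx hb
    have h1w : (1 : NCSeries α ℝ) (u ++ [c]) = 0 := by cases u <;> rfl
    -- the recursion `U(w) = -Σ_{x ≠ []} S(x) U(y)` on `s`
    have hrec : ∀ x ∈ s, transportSeries f x b (u ++ [c]) =
        -∑ p ∈ (NCSeries.splits (u ++ [c])).erase ([], u ++ [c]),
          transportSeries f b x p.1 * transportSeries f x b p.2 := by
      intro x hx
      have h := congrFun (hSU x hx) (u ++ [c])
      rw [NCSeries.mul_apply_eq_add_sum_erase, transportSeries_apply_nil, one_mul, h1w] at h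
      linarith
    -- derivative of the right-hand side
    have hderiv : HasDerivAt
        (fun x => -∑ p ∈ (NCSeries.splits (u ++ [c])).erase ([], u ++ [c]),
          transportSeries f b x p.1 * transportSeries f x b p.2)
        (-∑ p ∈ (NCSeries.splits (u ++ [c])).erase ([], u ++ [c]),
          ((NCSeries.letterSeries (fun c => f c a) * transportSeries f b a) p.1 *
              transportSeries f a b p.2 +
            transportSeries f b a p.1 *
              (-(transportSeries f a b * NCSeries.letterSeries (fun c => f c a)) p.2))) a := by
      refine HasDerivAt.neg (HasDerivAt.fun_sum fun p hp => ?_)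
      have hp' := Finset.mem_erase.mp hp
      have hpw : p.1 ++ p.2 = u ++ [c] := NCSeries.mem_splits.mp hp'.2
      have hp1 : p.1 ≠ [] := by
        intro h1
        apply hp'.1
        ext1
        · exact h1
        · simpa [h1] using hpw
      have hlen : p.2.length ≤ n := by
        have h2 := congrArg List.length hpw
        simp only [List.length_append, List.length_singleton] at h2 hw
        have : 0 < p.1.length := List.length_pos_iff.mpr hp1
        omega
      exact (hasDerivAt_transportSeries_right hs hso hf hb ha p.1).mul (ih p.2 hlen ha)
    -- identify the derivative
    have e1 : ∑ p ∈ (NCSeries.splits (u ++ [c])).erase ([], u ++ [c]),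
        (NCSeries.letterSeries (fun c => f c a) * transportSeries f b a) p.1 *
          transportSeries f a b p.2 =
        (NCSeries.letterSeries (fun c => f c a) * transportSeries f b a * transportSeries f a b)
          (u ++ [c]) := by
      rw [NCSeries.mul_apply_eq_add_sum_erase (_ * transportSeries f b a) (transportSeries f a b),
        NCSeries.letterSeries_mul_apply_nil, zero_mul, zero_add]
    have e2 : ∑ p ∈ (NCSeries.splits (u ++ [c])).erase ([], u ++ [c]),
        transportSeries f b a p.1 *
          (transportSeries f a b * NCSeries.letterSeries (fun c => f c a)) p.2 =
        (transportSeries f b a * (transportSeries f a b * NCSeries.letterSeries (fun c => f c a)))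
            (u ++ [c]) -
          (transportSeries f a b * NCSeries.letterSeries (fun c => f c a)) (u ++ [c]) := by
      rw [NCSeries.mul_apply_eq_add_sum_erase (transportSeries f b a), transportSeries_apply_nil,
        one_mul]
      ring
    have hval : (-∑ p ∈ (NCSeries.splits (u ++ [c])).erase ([], u ++ [c]),
          ((NCSeries.letterSeries (fun c => f c a) * transportSeries f b a) p.1 *
              transportSeries f a b p.2 +
            transportSeries f b a p.1 *
              (-(transportSeries f a b * NCSeries.letterSeries (fun c => f c a)) p.2))) =
        -(transportSeries f a b * NCSeries.letterSeries (fun c => f c a)) (u ++ [c]) := by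
      simp only [Finset.sum_add_distrib, mul_neg, Finset.sum_neg_distrib, e1, e2]
      rw [mul_assoc, hSU a ha, ← mul_assoc, hSU a ha, one_mul, mul_one]
      ring
    rw [hval] at hderiv
    refine hderiv.congr_of_eventuallyEq ?_
    filter_upwards [hs.mem_nhds ha] with x hx
    exact hrec x hx

/-- **Right recursion** (peeling the innermost letter):
`I_{u c}(a,b) = ∫_a^b I_u(t,b) f_c(t) dt`. [folklore] -/
theorem iterInt_append_singleton [DecidableEq α] {a b : ℝ} (ha : a ∈ s) (hb : b ∈ s) (u : List α)
    (c : α) : iterInt f (u ++ [c]) a b = ∫ t in a..b, iterInt f u t b * f c t := by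
  have hd : ∀ t ∈ uIcc a b, HasDerivAt (fun x => iterInt f (u ++ [c]) x b)
      (-(iterInt f u t b * f c t)) t := by
    intro t ht
    have h := hasDerivAt_transportSeries_left hs hso hf hb _ (u ++ [c]) le_rfl
      (hso.uIcc_subset ha hb ht)
    rwa [NCSeries.mul_letterSeries_apply_append_singleton] at h
  have hcont : ContinuousOn (fun t => iterInt f u t b) s := by
    refine continuousOn_of_forall_continuousAt fun t ht => ?_
    exact (hasDerivAt_transportSeries_left hs hso hf hb _ u le_rfl ht).continuousAt
  have hint : IntervalIntegrable (fun t => -(iterInt f u t b * f c t)) volume a b :=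
    ((hcont.mul (hf c)).mono (hso.uIcc_subset ha hb)).neg.intervalIntegrable
  have h := integral_eq_sub_of_hasDerivAt hd hint
  simp only [intervalIntegral.integral_neg] at h
  rw [iterInt_self_of_ne_nil f (by simp) b] at h
  linarith

/-- Continuity in the lower limit. [folklore] -/
theorem continuousOn_iterInt_left [DecidableEq α] {b : ℝ} (hb : b ∈ s) (w : List α) :
    ContinuousOn (fun a => iterInt f w a b) s :=
  continuousOn_of_forall_continuousAt fun _ ht =>
    (hasDerivAt_transportSeries_left hs hso hf hb _ w le_rfl ht).continuousAt

end LowerLimit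

section Positivity

variable {f : α → ℝ → ℝ} {s : Set ℝ} (hs : IsOpen s) (hso : s.OrdConnected)
  (hf : ∀ c, ContinuousOn (f c) s)
include hs hso hf

omit hs hf in
/-- Nonnegative densities give nonnegative iterated integrals (for `a ≤ b`). [folklore] -/
theorem iterInt_nonneg (hpos : ∀ c, ∀ t ∈ s, 0 ≤ f c t) {a : ℝ} (ha : a ∈ s) :
    ∀ (w : List α) {b : ℝ}, b ∈ s → a ≤ b → 0 ≤ iterInt f w a b
  | [], _, _, _ => zero_le_one
  | c :: w, b, hb, hab => by
    rw [iterInt_cons]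
    refine intervalIntegral.integral_nonneg hab fun t ht => ?_
    have hts : t ∈ s := hso.uIcc_subset ha hb (by rw [uIcc_of_le hab]; exact ht)
    exact mul_nonneg (hpos c t hts) (iterInt_nonneg hpos ha w hts ht.1)

/-- For nonnegative densities, `I_w(a,b)` decreases as the lower limit `a` increases
(`a' ≤ a ≤ b`). [folklore] -/
theorem iterInt_anti_left (hpos : ∀ c, ∀ t ∈ s, 0 ≤ f c t) {a' a b : ℝ} (ha' : a' ∈ s)
    (ha : a ∈ s) (hb : b ∈ s) (ha'a : a' ≤ a) (hab : a ≤ b) (w : List α) :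
    iterInt f w a b ≤ iterInt f w a' b := by
  classical
  rw [iterInt_chen hs hso hf ha' ha w hb, ← Finset.add_sum_erase _ _ (NCSeries.self_nil_mem_splits w),
    iterInt_nil, mul_one]
  refine le_add_of_nonneg_right (Finset.sum_nonneg fun p _ => mul_nonneg ?_ ?_)
  · exact iterInt_nonneg hso hpos ha p.1 hb hab
  · exact iterInt_nonneg hso hpos ha' p.2 ha ha'a

/-- For nonnegative densities, `I_w(a,b)` increases with the upper limit `b` (`a ≤ b ≤ b'`).
[folklore] -/
theorem iterInt_mono_right (hpos : ∀ c, ∀ t ∈ s, 0 ≤ f c t) {a b b' : ℝ} (ha : a ∈ s)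
    (hb : b ∈ s) (hb' : b' ∈ s) (hab : a ≤ b) (hbb' : b ≤ b') (w : List α) :
    iterInt f w a b ≤ iterInt f w a b' := by
  classical
  rw [iterInt_chen hs hso hf ha hb w hb', ← Finset.add_sum_erase _ _ (NCSeries.nil_self_mem_splits w),
    iterInt_nil, one_mul]
  refine le_add_of_nonneg_right (Finset.sum_nonneg fun p _ => mul_nonneg ?_ ?_)
  · exact iterInt_nonneg hso hpos hb p.1 hb' hbb'
  · exact iterInt_nonneg hso hpos ha p.2 hb hab

end Positivity

section SmallInterval

/-! ### Refined bounds near a singular endpoint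

Letters are split by a predicate `bdd` into *bounded* ones (`|f_c| ≤ M`) and *logarithmic* ones
(`|f_c(t)| ≤ K/t` near `0`, resp. `≤ K/(1-t)` near `1`). A word whose innermost (last) letter is
bounded has an iterated integral `O(x^q)` on `[a, x] ⊆ (0, x]`, `q` its number of bounded letters;
symmetrically at the top for words whose outermost (first) letter is bounded. -/

variable {f : α → ℝ → ℝ} {s : Set ℝ} (hs : IsOpen s) (hso : s.OrdConnected)
  (hf : ∀ c, ContinuousOn (f c) s) (bdd : α → Prop) [DecidablePred bdd]
include hs hso hf

/-- Number of bounded letters of a word. [folklore] -/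
def countBdd (bdd : α → Prop) [DecidablePred bdd] (w : List α) : ℕ := (w.filter fun c => bdd c).length

omit hs hso hf in
/-- The empty word has no bounded letter. [folklore] -/
@[simp] theorem countBdd_nil : countBdd bdd ([] : List α) = 0 := rfl

omit hs hso hf in
/-- Bounded-letter count of `c w`. [folklore] -/
theorem countBdd_cons (c : α) (w : List α) :
    countBdd bdd (c :: w) = (if bdd c then 1 else 0) + countBdd bdd w := by
  by_cases hc : bdd c <;> simp [countBdd, hc, add_comm]

omit hs hso hf in
/-- Bounded-letter count of `u c`. [folklore] -/
theorem countBdd_append_singleton (u : List α) (c : α) :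
    countBdd bdd (u ++ [c]) = countBdd bdd u + (if bdd c then 1 else 0) := by
  by_cases hc : bdd c <;> simp [countBdd, List.filter_append, hc]

/-- **Bottom lemma.** On `[a, x]` with `0 < a`, if bounded letters satisfy `|f_c| ≤ M` and the
others `|f_c(t)| ≤ K / t`, then a nonempty word whose last letter is bounded has
`|I_w(a,x)| ≤ K^{|w| - q} M^q x^q`, `q = countBdd w`. [folklore] -/
theorem abs_iterInt_le_of_last_bdd {K M : ℝ} (hK : 0 ≤ K) (hM : 0 ≤ M) {a : ℝ} (ha : a ∈ s)
    (ha0 : 0 < a) (hbd : ∀ c, bdd c → ∀ t ∈ s, a ≤ t → |f c t| ≤ M)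
    (hlog : ∀ c, ¬ bdd c → ∀ t ∈ s, a ≤ t → |f c t| ≤ K / t) :
    ∀ (w : List α) (hw : w ≠ []), bdd (w.getLast hw) → ∀ {x : ℝ}, x ∈ s → a ≤ x →
      |iterInt f w a x| ≤ K ^ (w.length - countBdd bdd w) * M ^ countBdd bdd w * x ^ countBdd bdd w
  | [], hw, _, _, _, _ => absurd rfl hw
  | [c], _, hc, x, hx, hax => by
    have hc' : bdd c := by simpa using hc
    have hx0 : 0 ≤ x := ha0.le.trans hax
    simp only [iterInt_cons, iterInt_nil, mul_one, List.length_singleton, countBdd_cons, hc',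
      if_true, countBdd_nil, add_zero, Nat.sub_self, pow_zero, one_mul, pow_one]
    have hsub : uIcc a x ⊆ s := hso.uIcc_subset ha hx
    calc |∫ t in a..x, f c t| ≤ M * |x - a| := by
          rw [← Real.norm_eq_abs]
          refine intervalIntegral.norm_integral_le_of_norm_le_const fun t ht => ?_
          rw [uIoc_of_le hax] at ht
          rw [Real.norm_eq_abs]
          exact hbd c hc' t (hsub (by rw [uIcc_of_le hax]; exact ⟨ht.1.le, ht.2⟩)) ht.1.le
      _ ≤ M * x := by
          rw [abs_of_nonneg (by linarith)]
          exact mul_le_mul_of_nonneg_left (by linarith) hM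
  | c :: d :: w, _, hlast, x, hx, hax => by
    have hne : d :: w ≠ [] := List.cons_ne_nil d w
    have hlast' : bdd ((d :: w).getLast hne) := by
      simpa [List.getLast_cons hne] using hlast
    have hx0 : 0 ≤ x := ha0.le.trans hax
    have hsub : uIcc a x ⊆ s := hso.uIcc_subset ha hx
    -- number of bounded letters of the tail is positive
    have hq : 1 ≤ countBdd bdd (d :: w) := by
      have : (d :: w).getLast hne ∈ (d :: w).filter fun c => bdd c :=
        List.mem_filter.mpr ⟨List.getLast_mem hne, by simpa using hlast'⟩
      exact List.length_pos_iff.mpr (List.ne_nil_of_mem this)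
    set q := countBdd bdd (d :: w) with hqdef
    set p := (d :: w).length - q with hpdef
    have IH : ∀ t ∈ s, a ≤ t → |iterInt f (d :: w) a t| ≤ K ^ p * M ^ q * t ^ q := fun t ht hat =>
      abs_iterInt_le_of_last_bdd hK hM ha ha0 hbd hlog (d :: w) hne hlast' ht hat
    have hcontI : ContinuousOn (fun t => f c t * iterInt f (d :: w) a t) (uIcc a x) :=
      (continuousOn_mul_iterInt hs hso hf ha c (d :: w)).mono hsub
    rw [iterInt_cons]
    have hqle : q ≤ (d :: w).length := by
      simp only [hqdef, countBdd]; exact List.length_filter_le _ _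
    by_cases hc : bdd c
    · -- bounded outer letter
      have hcount : countBdd bdd (c :: d :: w) = q + 1 := by rw [countBdd_cons, if_pos hc]; omega
      have hlen : (c :: d :: w).length - countBdd bdd (c :: d :: w) = p := by
        rw [hcount, List.length_cons]; omega
      rw [hlen, hcount]
      calc |∫ t in a..x, f c t * iterInt f (d :: w) a t|
          ≤ ∫ t in a..x, |f c t * iterInt f (d :: w) a t| := abs_integral_le_integral_abs hax
        _ ≤ ∫ t in a..x, M * (K ^ p * M ^ q * t ^ q) := by
            refine integral_mono_on hax hcontI.abs.intervalIntegrable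
              ((continuous_const.mul (continuous_pow _)).intervalIntegrable _ _ |>.const_mul _)
              fun t ht => ?_
            have hts : t ∈ s := hsub (by rw [uIcc_of_le hax]; exact ht)
            rw [abs_mul]
            exact mul_le_mul (hbd c hc t hts ht.1) (IH t hts ht.1) (abs_nonneg _) hM
        _ = M * (K ^ p * M ^ q) * ((x ^ (q + 1) - a ^ (q + 1)) / (q + 1)) := by
            rw [intervalIntegral.integral_const_mul, intervalIntegral.integral_const_mul, integral_pow]
            ring
        _ ≤ M * (K ^ p * M ^ q) * x ^ (q + 1) := by
            refine mul_le_mul_of_nonneg_left ?_ (by positivity)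
            rw [div_le_iff₀ (by positivity)]
            have ha' : 0 ≤ a ^ (q + 1) := by positivity
            have hx' : 0 ≤ x ^ (q + 1) := by positivity
            nlinarith
        _ = K ^ p * M ^ (q + 1) * x ^ (q + 1) := by ring
    · -- logarithmic outer letter
      have hcount : countBdd bdd (c :: d :: w) = q := by rw [countBdd_cons, if_neg hc]; omega
      have hlen : (c :: d :: w).length - countBdd bdd (c :: d :: w) = p + 1 := by
        rw [hcount, List.length_cons]; omega
      rw [hlen, hcount]
      obtain ⟨q', hq'⟩ : ∃ q', q = q' + 1 := ⟨q - 1, by omega⟩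
      calc |∫ t in a..x, f c t * iterInt f (d :: w) a t|
          ≤ ∫ t in a..x, |f c t * iterInt f (d :: w) a t| := abs_integral_le_integral_abs hax
        _ ≤ ∫ t in a..x, K * (K ^ p * M ^ q * t ^ q') := by
            refine integral_mono_on hax hcontI.abs.intervalIntegrable
              ((continuous_const.mul (continuous_pow _)).intervalIntegrable _ _ |>.const_mul _)
              fun t ht => ?_
            have hts : t ∈ s := hsub (by rw [uIcc_of_le hax]; exact ht)
            have ht0 : 0 < t := ha0.trans_le ht.1
            rw [abs_mul]
            calc |f c t| * |iterInt f (d :: w) a t| ≤ (K / t) * (K ^ p * M ^ q * t ^ q) :=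
                  mul_le_mul (hlog c hc t hts ht.1) (IH t hts ht.1) (abs_nonneg _) (by positivity)
              _ = K * (K ^ p * M ^ q * t ^ q') := by
                  rw [hq', pow_succ, pow_succ]; field_simp
        _ = K * (K ^ p * M ^ q) * ((x ^ (q' + 1) - a ^ (q' + 1)) / (q' + 1)) := by
            rw [intervalIntegral.integral_const_mul, intervalIntegral.integral_const_mul, integral_pow]
            ring
        _ ≤ K * (K ^ p * M ^ q) * x ^ (q' + 1) := by
            refine mul_le_mul_of_nonneg_left ?_ (by positivity)
            rw [div_le_iff₀ (by positivity)]
            have ha' : 0 ≤ a ^ (q' + 1) := by positivity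
            have hx' : 0 ≤ x ^ (q' + 1) := by positivity
            nlinarith
        _ = K ^ (p + 1) * M ^ q * x ^ q := by rw [hq']; ring

omit hs hso hf in
/-- `∫_x^b (1-t)^n dt = ((1-x)^{n+1} - (1-b)^{n+1})/(n+1)`. [folklore] -/
theorem integral_one_sub_pow_of_le (x b : ℝ) (n : ℕ) :
    ∫ t in x..b, (1 - t) ^ n = ((1 - x) ^ (n + 1) - (1 - b) ^ (n + 1)) / (n + 1) := by
  rw [intervalIntegral.integral_comp_sub_left (fun u => u ^ n) 1, integral_pow]

/-- **Top lemma.** On `[x, b]` with `b < 1`, if bounded letters satisfy `|f_c| ≤ M` and the others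
`|f_c(t)| ≤ K / (1 - t)`, then a nonempty word whose first letter is bounded has
`|I_w(x,b)| ≤ K^{|w| - q} M^q (1-x)^q`, `q = countBdd w`. [folklore] -/
theorem abs_iterInt_le_of_head_bdd [DecidableEq α] {K M : ℝ} (hK : 0 ≤ K) (hM : 0 ≤ M) {b : ℝ}
    (hb : b ∈ s) (hb1 : b < 1) (hbd : ∀ c, bdd c → ∀ t ∈ s, t ≤ b → |f c t| ≤ M)
    (hlog : ∀ c, ¬ bdd c → ∀ t ∈ s, t ≤ b → |f c t| ≤ K / (1 - t)) (w : List α) :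
    ∀ (hw : w ≠ []), bdd (w.head hw) → ∀ {x : ℝ}, x ∈ s → x ≤ b →
      |iterInt f w x b| ≤
        K ^ (w.length - countBdd bdd w) * M ^ countBdd bdd w * (1 - x) ^ countBdd bdd w := by
  induction w using List.reverseRecOn with
  | nil => intro hw; exact absurd rfl hw
  | append_singleton u c ih =>
    intro hw hhead x hx hxb
    have hsub : uIcc x b ⊆ s := hso.uIcc_subset hx hb
    have hx1 : 0 ≤ 1 - x := by linarith
    by_cases hu : u = []
    · subst hu
      have hc : bdd c := by simpa using hhead
      simp only [List.nil_append, iterInt_cons, iterInt_nil, mul_one, List.length_singleton,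
        countBdd_cons, hc, if_true, countBdd_nil, add_zero, Nat.sub_self, pow_zero, one_mul, pow_one]
      calc |∫ t in x..b, f c t| ≤ M * |b - x| := by
            rw [← Real.norm_eq_abs]
            refine intervalIntegral.norm_integral_le_of_norm_le_const fun t ht => ?_
            rw [uIoc_of_le hxb] at ht
            rw [Real.norm_eq_abs]
            exact hbd c hc t (hsub (by rw [uIcc_of_le hxb]; exact ⟨ht.1.le, ht.2⟩)) ht.2
        _ ≤ M * (1 - x) := by
            rw [abs_of_nonneg (by linarith)]
            exact mul_le_mul_of_nonneg_left (by linarith) hM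
    · have hhead' : bdd (u.head hu) := by
        rwa [List.head_append_of_ne_nil] at hhead
      -- number of bounded letters of the prefix is positive
      have hq : 1 ≤ countBdd bdd u := by
        have : u.head hu ∈ u.filter fun c => bdd c :=
          List.mem_filter.mpr ⟨List.head_mem hu, by simpa using hhead'⟩
        exact List.length_pos_iff.mpr (List.ne_nil_of_mem this)
      set q := countBdd bdd u with hqdef
      set p := u.length - q with hpdef
      have hqle : q ≤ u.length := by simp only [hqdef, countBdd]; exact List.length_filter_le _ _
      have IH : ∀ t ∈ s, t ≤ b → |iterInt f u t b| ≤ K ^ p * M ^ q * (1 - t) ^ q :=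
        fun t ht htb => ih hu hhead' ht htb
      have hcontI : ContinuousOn (fun t => iterInt f u t b * f c t) (uIcc x b) :=
        ((continuousOn_iterInt_left hs hso hf hb u).mul (hf c)).mono hsub
      rw [iterInt_append_singleton hs hso hf hx hb u c]
      by_cases hc : bdd c
      · have hcount : countBdd bdd (u ++ [c]) = q + 1 := by
          rw [countBdd_append_singleton, if_pos hc]
        have hlen : (u ++ [c]).length - countBdd bdd (u ++ [c]) = p := by
          rw [hcount, List.length_append, List.length_singleton]; omega
        rw [hlen, hcount]
        calc |∫ t in x..b, iterInt f u t b * f c t|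
            ≤ ∫ t in x..b, |iterInt f u t b * f c t| := abs_integral_le_integral_abs hxb
          _ ≤ ∫ t in x..b, (K ^ p * M ^ q * (1 - t) ^ q) * M := by
              refine integral_mono_on hxb hcontI.abs.intervalIntegrable
                (((continuous_const.mul ((continuous_const.sub continuous_id).pow _)).mul
                  continuous_const).intervalIntegrable _ _) fun t ht => ?_
              have hts : t ∈ s := hsub (by rw [uIcc_of_le hxb]; exact ht)
              rw [abs_mul]
              exact mul_le_mul (IH t hts ht.2) (hbd c hc t hts ht.2) (abs_nonneg _) (by
                have : 0 ≤ 1 - t := by linarith [ht.2]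
                positivity)
          _ = K ^ p * M ^ q * M * (((1 - x) ^ (q + 1) - (1 - b) ^ (q + 1)) / (q + 1)) := by
              rw [intervalIntegral.integral_mul_const, intervalIntegral.integral_const_mul,
                integral_one_sub_pow_of_le]
              ring
          _ ≤ K ^ p * M ^ q * M * (1 - x) ^ (q + 1) := by
              refine mul_le_mul_of_nonneg_left ?_ (by positivity)
              rw [div_le_iff₀ (by positivity)]
              have hb' : 0 ≤ (1 - b) ^ (q + 1) := by
                have : 0 ≤ 1 - b := by linarith
                positivity
              have hx' : 0 ≤ (1 - x) ^ (q + 1) := by positivity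
              nlinarith
          _ = K ^ p * M ^ (q + 1) * (1 - x) ^ (q + 1) := by ring
      · have hcount : countBdd bdd (u ++ [c]) = q := by
          rw [countBdd_append_singleton, if_neg hc, add_zero]
        have hlen : (u ++ [c]).length - countBdd bdd (u ++ [c]) = p + 1 := by
          rw [hcount, List.length_append, List.length_singleton]; omega
        rw [hlen, hcount]
        obtain ⟨q', hq'⟩ : ∃ q', q = q' + 1 := ⟨q - 1, by omega⟩
        calc |∫ t in x..b, iterInt f u t b * f c t|
            ≤ ∫ t in x..b, |iterInt f u t b * f c t| := abs_integral_le_integral_abs hxb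
          _ ≤ ∫ t in x..b, (K ^ p * M ^ q * (1 - t) ^ q') * K := by
              refine integral_mono_on hxb hcontI.abs.intervalIntegrable
                (((continuous_const.mul ((continuous_const.sub continuous_id).pow _)).mul
                  continuous_const).intervalIntegrable _ _) fun t ht => ?_
              have hts : t ∈ s := hsub (by rw [uIcc_of_le hxb]; exact ht)
              have ht1 : 0 < 1 - t := by linarith [ht.2]
              rw [abs_mul]
              calc |iterInt f u t b| * |f c t| ≤ (K ^ p * M ^ q * (1 - t) ^ q) * (K / (1 - t)) :=
                    mul_le_mul (IH t hts ht.2) (hlog c hc t hts ht.2) (abs_nonneg _) (by positivity)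
                _ = (K ^ p * M ^ q * (1 - t) ^ q') * K := by
                    rw [hq', pow_succ, pow_succ]; field_simp
          _ = K ^ p * M ^ q * K * (((1 - x) ^ (q' + 1) - (1 - b) ^ (q' + 1)) / (q' + 1)) := by
              rw [intervalIntegral.integral_mul_const, intervalIntegral.integral_const_mul,
                integral_one_sub_pow_of_le]
              ring
          _ ≤ K ^ p * M ^ q * K * (1 - x) ^ (q' + 1) := by
              refine mul_le_mul_of_nonneg_left ?_ (by positivity)
              rw [div_le_iff₀ (by positivity)]
              have hb' : 0 ≤ (1 - b) ^ (q' + 1) := by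
                have : 0 ≤ 1 - b := by linarith
                positivity
              have hx' : 0 ≤ (1 - x) ^ (q' + 1) := by positivity
              nlinarith
          _ = K ^ (p + 1) * M ^ q * (1 - x) ^ q := by rw [hq']; ring

end SmallInterval

section Reparam

variable {f : α → ℝ → ℝ} {s : Set ℝ} (hs : IsOpen s) (hso : s.OrdConnected)
  (hf : ∀ c, ContinuousOn (f c) s)
include hs hso hf

/-- **Reparametrisation invariance.** For a `C¹` change of variable `φ : s' → s`
(`s'` an open interval), `I^f_w(φ a, φ b) = I^{(f ∘ φ) φ'}_w(a, b)`: iterated integrals only depend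
on the pulled-back forms `f_c(φ(x)) φ'(x) dx`. [folklore] -/
theorem iterInt_comp {s' : Set ℝ} (hs' : IsOpen s') (hso' : s'.OrdConnected) {φ φ' : ℝ → ℝ}
    (hφ : ∀ x ∈ s', HasDerivAt φ (φ' x) x) (hφ' : ContinuousOn φ' s') (hmaps : MapsTo φ s' s)
    {a : ℝ} (ha : a ∈ s') :
    ∀ (w : List α) {b : ℝ}, b ∈ s' →
      iterInt f w (φ a) (φ b) = iterInt (fun c x => f c (φ x) * φ' x) w a b
  | [], _, _ => rfl
  | c :: w, b, hb => by
    have hsub : uIcc a b ⊆ s' := hso'.uIcc_subset ha hb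
    have hφc : ContinuousOn φ s' := fun x hx => (hφ x hx).continuousAt.continuousWithinAt
    have himg : φ '' uIcc a b ⊆ s := fun y ⟨x, hx, hxy⟩ => hxy ▸ hmaps (hsub hx)
    rw [iterInt_cons, iterInt_cons]
    have hg : ContinuousOn (fun t => f c t * iterInt f w (φ a) t) (φ '' uIcc a b) :=
      (continuousOn_mul_iterInt hs hso hf (hmaps ha) c w).mono himg
    rw [← intervalIntegral.integral_comp_mul_deriv' (fun x hx => hφ x (hsub hx)) (hφ'.mono hsub) hg]
    refine integral_congr fun x hx => ?_
    simp only [Function.comp_apply]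
    rw [iterInt_comp hs' hso' hφ hφ' hmaps ha w (hsub hx)]
    ring

/-- Reparametrisation invariance of the transport series. [folklore] -/
theorem transportSeries_comp {s' : Set ℝ} (hs' : IsOpen s') (hso' : s'.OrdConnected)
    {φ φ' : ℝ → ℝ} (hφ : ∀ x ∈ s', HasDerivAt φ (φ' x) x) (hφ' : ContinuousOn φ' s')
    (hmaps : MapsTo φ s' s) {a b : ℝ} (ha : a ∈ s') (hb : b ∈ s') :
    transportSeries f (φ a) (φ b) = transportSeries (fun c x => f c (φ x) * φ' x) a b := by
  ext w
  exact iterInt_comp hs hso hf hs' hso' hφ hφ' hmaps ha w hb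

end Reparam

end Literature.NumberTheory.Transcendental
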